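import Literature.IUT.HodgeArakelov.LabelClassesOfCuspsCor24iProofs2
import Literature.IUT.HodgeTheaters.TemperedCoveringsProofs

/-!
# [IUTchII] Cor 2.4 (i): the input `h25` via [IUTchI] Prop 2.4 (i) — the "pro-`Σ` part" route AT THE `X̲_v`-LEVEL, PROVED

S. Mochizuki, *Inter-universal Teichmüller theory II*, kurims manuscript (Dec. 2020), §2, Def 2.3 (i)–(iii) pp. 67–68,
Cor 2.4 (i) pp. 69–71; *Inter-universal Teichmüller theory I*, kurims manuscript, Prop 2.4 (i)/(iii) p. 49, Cor 2.5 +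
proof p. 51, Rmk 2.5.2 p. 52 ([IUTchII] Cor 2.4 (i), kurims pp.69-71) [claim: Mochizuki2012, status: disputed]
(D-0012 claim key; series DISPUTED; nothing printed is asserted — every [IUTchI] §2 input is a HYPOTHESIS, named by
abc-iut-L5-t1's typed predicates `Prop24i`, `Prop24iii`).

PROOF-ONLY companion (no definitions) of `LabelClassesOfCusps` (abc-iut-L6-t1; node `IUTchII:Cor2.4(i)`),
`LabelClassesOfCuspsCor24iProofs`/`…Proofs2` (abc-iut-w4-d012) and `TemperedCoveringsProofs` (abc-iut-L5-t1 lineage: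
`StableCurveTemperedData.cor25Inertia_of_prop24i`).  abc-iut cell, wave 5, seat abc-iut-w5-d132 — second repair route for
finding F1 of the RQ7 audit of the B13 bridge p412701 (abc-iut-L6-t7), complementary to `LabelClassesOfCuspsCor24iH25Flat`.

THE POINT.  [IUTchII] p. 70 l. −4/−3 applies "[IUTchI], Corollary 2.5 [cf. also [IUTchI], Remark 2.5.2]" to
`I^{γ'}_t ⊆ Π^±_v` where `I_t ⊆ Π_v` is a cuspidal inertia group of `Π_v` (p. 69), i.e. — the covering `X̲̲_v → X̲_v` being
totally ramified at the cusps (Def 2.3 (iii) p. 68) — an index-`l` OPEN SUBGROUP of a cuspidal inertia group of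
`Π^±_v = Π^tp_{X̲_v}`.  [IUTchI] Cor 2.5 is STATED (p. 51) for the inertia groups themselves, but its PROOF ("by applying
Proposition 2.4, (i), to the unique maximal pro-`Σ` subgroup of `I_x`"; Rmk 2.5.2: "the portion whose proof only requires
the use of Proposition 2.4, (i)") gives the conclusion for ANY subgroup of `Π^tp_X` containing a `Π^tp_X`-conjugate of a
nontrivial compact pro-`Σ` subgroup of `Δ^tp_X`.  We kernel-check exactly that, over abc-iut-L5-t1's data:

* `cor25_conj_smul_range_eq_of_prop24i` — for `D : StableCurveTemperedData`, from `D.Prop24i` (hypothesis): if a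
  `Π̂_X`-conjugate `(Π^tp_X)^γ` contains `(Λ)^t` for some nontrivial compact pro-`Σ` subgroup `Λ ⊆ Δ^tp_X` and `t ∈ Π^tp_X`,
  then `(Π^tp_X)^γ = Π^tp_X` (the proof of abc-iut-L5-t1's `cor25Inertia_of_prop24i`, clause `conj_eq_iff`, with `I_x`
  replaced by `Λ`).  PROVED.
* `PlusMinusTower.h25_of_pmData_proSigma` — at the `X̲_v`-LEVEL of abc-iut-L6-t7's B13 (an identification
  `e : Π̂^±_v ⥲ Π̂_{X̲_v}` carrying `Π^±_v` onto the image of `Π^tp_{X̲_v}`), for ANY subgroup `I ⊆ Π̂^cor_v` whose part in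
  `Π̂^±_v` contains, after transport, a `Π^tp_{X̲_v}`-conjugate of a nontrivial compact pro-`Σ` subgroup of `Δ^tp_{X̲_v}`
  (datum `hsub` — at the model: the pro-`Σ` part of `I_t ≅ Ẑ`), `D.Prop24i` and the normal terminality of `Π^tp_{X̲_v}`
  (`D.Prop24iii`) give LITERALLY hypothesis `h25` of `cor24_i_of_inputs`: for `γ' ∈ Δ̂^±_v`, `I^{γ'} ⊆ Π^±_v ⟹ γ' ∈ Π^±_v`.
  PROVED.  (So B13 needs only ONE extra data clause — `hsub` for the `Π_v`-cuspidal inertia groups — and `Prop24i`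
  in place of `Cor25Inertia`, to serve the printed `I_t`.)
* `cor24_i_of_pmData_proSigma` / `cor24_i'_of_pmData_proSigma` — the node predicate `Cor24_i W C H I` and the decl of
  record `Cor24_i' Dec W C Ld I` from these data + the remaining printed inputs (B) `h23vi` (GAP-LEDGER G-w4d012-2) and
  (C) `h23v` (B13 `StableCurveAgreement.h23v`) as hypotheses.  PROVED.

Typed ≠ proved; no side is taken on [IUTchIII] Cor 3.12.
-/

namespace Literature.IUT.HodgeArakelov

open Literature.IUT.HodgeTheaters
open Literature.AnabelianGeometry.AbsoluteAnabelian (IsNormallyTerminal)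
open Literature.AnabelianGeometry.SemiGraphs (IsProSigma)
open scoped Pointwise

universe u

/-- **IUTchI:Cor2.5 — the "Prop 2.4 (i) portion" in its natural generality** (proof p. 51 / Rmk 2.5.2 p. 52): for
[IUTchI] §2 data `D` satisfying the typed Prop 2.4 (i) (`D.Prop24i`, hypothesis), a `Π̂_X`-conjugate `(Π^tp_X)^γ` of
`Π^tp_X` that contains a `Π^tp_X`-conjugate `Λ^t` of a NONTRIVIAL COMPACT PRO-`Σ` subgroup `Λ ⊆ Δ^tp_X` is equal to `Π^tp_X`.
(abc-iut-L5-t1's `cor25Inertia_of_prop24i`, clause `conj_eq_iff`, with the representative inertia group `I_x` replaced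
by `Λ`; applied in [IUTchII] Cor 2.4 (i) p. 70 to the pro-`Σ` part of `I_t`.)  PROVED. ([IUTchII] Cor 2.4 (i) p.70)
[claim: Mochizuki2012, status: disputed] -/
theorem cor25_conj_smul_range_eq_of_prop24i (D : StableCurveTemperedData.{u}) (h : D.Prop24i)
    (Λ : Subgroup D.DeltaTp) (hc : IsCompact (Λ : Set D.DeltaTp)) (hne : Λ ≠ ⊥)
    (hS : IsProSigma D.graph.Sigma Λ) (γ : D.PiHat) (t : D.PiTp)
    (hle : MulAut.conj (D.ιX t) • ((Λ.map D.DeltaTp.subtype).map D.ιX) ≤ MulAut.conj γ • D.ιX.range) :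
    MulAut.conj γ • D.ιX.range = D.ιX.range := by
  -- apply Prop. 2.4 (i) to `Λ` and `γ' := γ⁻¹ · t`
  have hγ' : γ⁻¹ * D.ιX t ∈ D.ιX.range := by
    refine h.mem_of_conj_le Λ hc hne hS _ fun p hp => ?_
    refine D.conj_mem_map_deltaTp (by rw [D.prHat_ιX]; exact p.2) ?_
    have hmem : D.ιX t * D.ιX (p : D.PiTp) * (D.ιX t)⁻¹ ∈ MulAut.conj γ • D.ιX.range :=
      hle (Subgroup.smul_mem_pointwise_smul _ _ _ ⟨(p : D.PiTp), ⟨p, hp, rfl⟩, rfl⟩)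
    rw [Subgroup.mem_pointwise_smul_iff_inv_smul_mem, MulAut.smul_def, MulAut.conj_inv_apply] at hmem
    simpa only [mul_inv_rev, inv_inv, mul_assoc] using hmem
  have hγmem : γ ∈ D.ιX.range := by
    have e : γ = D.ιX t * (γ⁻¹ * D.ιX t)⁻¹ := by
      rw [mul_inv_rev, inv_inv, mul_inv_cancel_left]
    rw [e]
    exact mul_mem ⟨t, rfl⟩ (inv_mem hγ')
  exact Subgroup.conj_smul_eq_self_of_mem hγmem

/-- **IUTchI:Prop2.4(iii)** companion: under normal terminality of `Π^tp_X` in `Π̂_X`, `(Π^tp_X)^γ = Π^tp_X` forces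
`γ ∈ Π^tp_X`; with `cor25_conj_smul_range_eq_of_prop24i` this is the form used at [IUTchII] p. 70 ("implies that
`γ' ∈ Δ^±_v`").  PROVED. ([IUTchII] Cor 2.4 (i) p.70) [claim: Mochizuki2012, status: disputed] -/
theorem cor25_mem_range_of_prop24i (D : StableCurveTemperedData.{u}) (h : D.Prop24i)
    (hNT : IsNormallyTerminal D.ιX.range) (Λ : Subgroup D.DeltaTp) (hc : IsCompact (Λ : Set D.DeltaTp))
    (hne : Λ ≠ ⊥) (hS : IsProSigma D.graph.Sigma Λ) (γ : D.PiHat) (t : D.PiTp)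
    (hle : MulAut.conj (D.ιX t) • ((Λ.map D.DeltaTp.subtype).map D.ιX) ≤ MulAut.conj γ • D.ιX.range) :
    γ ∈ D.ιX.range := by
  have heq := cor25_conj_smul_range_eq_of_prop24i D h Λ hc hne hS γ t hle
  rw [← hNT.normalizer_eq, Subgroup.mem_normalizer_iff]
  intro x
  rw [← SetLike.ext_iff.mp heq (γ * x * γ⁻¹), Subgroup.mem_pointwise_smul_iff_inv_smul_mem]
  simp [MulAut.smul_def, mul_assoc]

namespace PlusMinusTower

section GroupTheory

variable {G G' : Type u} [Group G] [Group G']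

/-- Transport of conjugates along an isomorphism out of a subgroup `Q ⊆ G` (abc-iut-L6-t7's `map_subgroupOf_conj`,
re-proved privately: the B13 file is not yet importable). [folklore] -/
private theorem map_subgroupOf_conj'' {Q : Subgroup G} (e : Q ≃* G') (I : Subgroup G) {γ : G} (hγ : γ ∈ Q) :
    ((MulAut.conj γ • I).subgroupOf Q).map e.toMonoidHom =
      MulAut.conj (e ⟨γ, hγ⟩) • (I.subgroupOf Q).map e.toMonoidHom := by
  ext y
  simp only [Subgroup.mem_map, Subgroup.mem_subgroupOf, MulEquiv.coe_toMonoidHom,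
    Subgroup.mem_pointwise_smul_iff_inv_smul_mem, MulAut.smul_def, MulAut.conj_inv_apply]
  constructor
  · rintro ⟨q, hq, rfl⟩
    refine ⟨⟨γ⁻¹ * q * γ, Q.mul_mem (Q.mul_mem (Q.inv_mem hγ) q.2) hγ⟩, hq, ?_⟩
    have : (⟨γ⁻¹ * ↑q * γ, Q.mul_mem (Q.mul_mem (Q.inv_mem hγ) q.2) hγ⟩ : Q) =
        ⟨γ, hγ⟩⁻¹ * q * ⟨γ, hγ⟩ := rfl
    rw [this, map_mul, map_mul, map_inv]
  · rintro ⟨q, hq, hqe⟩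
    have hmem : γ * ↑q * γ⁻¹ ∈ Q := Q.mul_mem (Q.mul_mem hγ q.2) (Q.inv_mem hγ)
    refine ⟨⟨γ * q * γ⁻¹, hmem⟩, ?_, ?_⟩
    · show γ⁻¹ * (γ * ↑q * γ⁻¹) * γ ∈ I
      simpa [mul_assoc] using hq
    · have : (⟨γ * ↑q * γ⁻¹, hmem⟩ : Q) = ⟨γ, hγ⟩ * q * ⟨γ, hγ⟩⁻¹ := rfl
      rw [this, map_mul, map_mul, map_inv, hqe]
      group

/-- Membership read through the transport. [folklore] -/
private theorem mem_iff_of_map_subgroupOf_eq' {Q : Subgroup G} (e : Q ≃* G') {K : Subgroup G} {R : Subgroup G'}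
    (hKR : (K.subgroupOf Q).map e.toMonoidHom = R) (g : Q) : (g : G) ∈ K ↔ e g ∈ R := by
  rw [← hKR, Subgroup.mem_map]
  constructor
  · intro hg
    exact ⟨g, Subgroup.mem_subgroupOf.mpr hg, rfl⟩
  · rintro ⟨q, hq, hqe⟩
    rw [MulEquiv.coe_toMonoidHom, e.apply_eq_iff_eq] at hqe
    subst hqe
    exact Subgroup.mem_subgroupOf.mp hq

end GroupTheory

variable {S : BadPlaceSetting.{u}} {P : TopGroup.{u}} {T : TemperedCoverings S P}
  (W : PlusMinusTower T) (D : StableCurveTemperedData.{u})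

/-- **IUTchII:Cor2.4(i)** — hypothesis `h25` of `cor24_i_of_inputs` ("by [IUTchI], Corollary 2.5 [cf. also [IUTchI],
Remark 2.5.2], the inclusion `I^{γ'}_t ⊆ Π^±_{v□} ⊆ Π^±_v` implies that `γ' ∈ Δ^±_v`", p. 70, `γ' ∈ Δ̂^±_v`) AT THE
`X̲_v`-LEVEL of B13: given `e : Π̂^±_v ⥲ Π̂_{X̲_v}` carrying `Π^±_v` onto the image of `Π^tp_{X̲_v}` (`hmap`), a subgroup `I`
whose trace on `Π̂^±_v` contains, after transport, `Λ^t` for a nontrivial compact pro-`Σ` `Λ ⊆ Δ^tp_{X̲_v}` and `t ∈ Π^tp_{X̲_v}`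
(`hsub` — for the printed `I_t ⊆ Π_v`: its pro-`Σ` part, [IUTchI] proof of Cor 2.5 p. 51), the typed Prop 2.4 (i) and the
normal terminality of `Π^tp_{X̲_v}` in `Π̂_{X̲_v}` — HYPOTHESES: `I^{γ'} ⊆ Π^±_v ⟹ γ' ∈ Π^±_v`.  PROVED.
([IUTchII] Cor 2.4 (i) p.70) [claim: Mochizuki2012, status: disputed] -/
theorem h25_of_pmData_proSigma (e : W.pmHat ≃* D.PiHat)
    (hmap : (W.piPM.subgroupOf W.pmHat).map e.toMonoidHom = D.ιX.range)
    (h24i : D.Prop24i) (hNT : IsNormallyTerminal D.ιX.range) {I : Subgroup W.Corhat}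
    (hsub : ∃ (Λ : Subgroup D.DeltaTp) (t : D.PiTp), IsCompact (Λ : Set D.DeltaTp) ∧ Λ ≠ ⊥ ∧
      IsProSigma D.graph.Sigma Λ ∧
      MulAut.conj (D.ιX t) • ((Λ.map D.DeltaTp.subtype).map D.ιX) ≤ (I.subgroupOf W.pmHat).map e.toMonoidHom) :
    ∀ γ' : W.Corhat, γ' ∈ W.pmHat ⊓ W.aug.ker →
      I.map (MulAut.conj γ').toMonoidHom ≤ W.piPM → γ' ∈ W.piPM := by
  intro γ' hγ' hc
  obtain ⟨Λ, t, hΛc, hΛne, hΛS, hΛI⟩ := hsub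
  have hγ'pm : γ' ∈ W.pmHat := (Subgroup.mem_inf.mp hγ').1
  set g : D.PiHat := e ⟨γ', hγ'pm⟩ with hg
  -- transport `I^{γ'} ⊆ Π^±_v` along `e`: `g · e(I ∩ Π̂^±_v) · g⁻¹ ⊆ Π^tp`
  have hle1 : MulAut.conj g • (I.subgroupOf W.pmHat).map e.toMonoidHom ≤ D.ιX.range := by
    rw [hg, ← map_subgroupOf_conj'' e I hγ'pm, ← hmap]
    exact Subgroup.map_mono fun _ hq => hc hq
  -- hence `(Λ^t)^g ⊆ Π^tp`, i.e. `Λ^t ⊆ (Π^tp)^{g⁻¹}`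
  have hle2 : MulAut.conj (D.ιX t) • ((Λ.map D.DeltaTp.subtype).map D.ιX) ≤ MulAut.conj g⁻¹ • D.ιX.range := by
    rw [map_inv, ← Subgroup.pointwise_smul_subset_iff]
    exact (Subgroup.pointwise_smul_le_pointwise_smul_iff.mpr hΛI).trans hle1
  have hg' : g ∈ D.ιX.range := by
    have := cor25_mem_range_of_prop24i D h24i hNT Λ hΛc hΛne hΛS g⁻¹ t hle2
    simpa using D.ιX.range.inv_mem this
  exact (mem_iff_of_map_subgroupOf_eq' e hmap ⟨γ', hγ'pm⟩).mpr hg'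

end PlusMinusTower

section Assembly

variable {S : BadPlaceSetting.{u}} {P : TopGroup.{u}} {T : TemperedCoverings S P}
  (W : PlusMinusTower T) (C : CuspidalInertiaData W) (D : StableCurveTemperedData.{u})

/-- **IUTchII:Cor2.4(i)** for ANY `Π_{v□}` (the typed `Cor24_i W C H I`), `X̲_v`-level route: B13-style identification
`e : Π̂^±_v ⥲ Π̂_{X̲_v}` + the pro-`Σ`-part datum for the `Π_v`-cuspidal inertia group `I` + typed Prop 2.4 (i)/(iii) (input
(A), hypotheses) + the printed inputs (B) `h23vi` and (C) `h23v` as hypotheses.  PROVED via `cor24_i_of_inputs`.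
([IUTchII] Cor 2.4 (i) pp.70-71) [claim: Mochizuki2012, status: disputed] -/
theorem cor24_i_of_pmData_proSigma (H : Subgroup P) (I : Subgroup W.Corhat) (e : W.pmHat ≃* D.PiHat)
    (hmap : (W.piPM.subgroupOf W.pmHat).map e.toMonoidHom = D.ιX.range)
    (h24i : D.Prop24i) (h24iii : D.Prop24iii)
    (hsub : C.IsCuspidalInertia W.piV I → ∃ (Λ : Subgroup D.DeltaTp) (t : D.PiTp),
      IsCompact (Λ : Set D.DeltaTp) ∧ Λ ≠ ⊥ ∧ IsProSigma D.graph.Sigma Λ ∧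
      MulAut.conj (D.ιX t) • ((Λ.map D.DeltaTp.subtype).map D.ιX) ≤ (I.subgroupOf W.pmHat).map e.toMonoidHom)
    (h23vi : ∀ γ' : W.Corhat, γ' ∈ W.piPM ⊓ W.aug.ker →
      I.map (MulAut.conj γ').toMonoidHom ≤ W.pmBox H → γ' ∈ closure (W.deltaPmBox H : Set W.Corhat))
    (h23v : ∀ γ' : W.Corhat, γ' ∈ W.piPM ⊓ W.aug.ker →
      γ' ∈ closure (W.deltaPmBox H : Set W.Corhat) → γ' ∈ W.deltaPmBox H) :
    Literature.IUT.HodgeArakelov.Cor24_i W C H I := by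
  intro hI hIΔ
  exact cor24_i_of_inputs W C H I
    (W.h25_of_pmData_proSigma D e hmap h24i h24iii.pi.isNormallyTerminal (hsub hI)) h23vi h23v hI hIΔ

variable {Dth : EtaleThetaData S.toThetaSetting P} (Dec : SubgraphDecomposition S T Dth)
  {L : LabCuspStructure C} (Ld : LabelledDecomposition Dec L)

/-- **IUTchII:Cor2.4(i)′** — the decl of record `Cor24_i' Dec W C Ld I` (printed family `□ ∈ {•t, ▶}`), `X̲_v`-level
route: input (A) DISCHARGED to typed Prop 2.4 (i)/(iii) + the identification and pro-`Σ` data; (B)/(C) per admissible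
`Π_{v□}` as hypotheses.  PROVED. ([IUTchII] Cor 2.4 (i) pp.70-71) [claim: Mochizuki2012, status: disputed] -/
theorem cor24_i'_of_pmData_proSigma (I : Subgroup W.Corhat) (e : W.pmHat ≃* D.PiHat)
    (hmap : (W.piPM.subgroupOf W.pmHat).map e.toMonoidHom = D.ιX.range)
    (h24i : D.Prop24i) (h24iii : D.Prop24iii)
    (hsub : C.IsCuspidalInertia W.piV I → ∃ (Λ : Subgroup D.DeltaTp) (t : D.PiTp),
      IsCompact (Λ : Set D.DeltaTp) ∧ Λ ≠ ⊥ ∧ IsProSigma D.graph.Sigma Λ ∧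
      MulAut.conj (D.ιX t) • ((Λ.map D.DeltaTp.subtype).map D.ιX) ≤ (I.subgroupOf W.pmHat).map e.toMonoidHom)
    (h23 : ∀ H : Subgroup P, Cor24_family Dec Ld H →
      (∀ γ' : W.Corhat, γ' ∈ W.piPM ⊓ W.aug.ker →
          I.map (MulAut.conj γ').toMonoidHom ≤ W.pmBox H → γ' ∈ closure (W.deltaPmBox H : Set W.Corhat)) ∧
        (∀ γ' : W.Corhat, γ' ∈ W.piPM ⊓ W.aug.ker →
          γ' ∈ closure (W.deltaPmBox H : Set W.Corhat) → γ' ∈ W.deltaPmBox H)) :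
    Literature.IUT.HodgeArakelov.Cor24_i' Dec W C Ld I := by
  intro H hH hI hIΔ
  obtain ⟨h23vi, h23v⟩ := h23 H hH
  exact cor24_i_of_pmData_proSigma W C D H I e hmap h24i h24iii hsub h23vi h23v hI hIΔ

end Assembly

end Literature.IUT.HodgeArakelov
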